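import Mathlib
import HarnessLib
import HarnessLib.Audit
import Summits.AtomisticToContinuum.Statement
import Literature.Geometry.DiscreteGeometry.KissingPatterns
import Literature.MathematicalPhysics.StatisticalMechanics.LennardJonesClusters
import Summits.AtomisticToContinuum.Crystallization.Theorems.ReggeStarCoercivityDefectFreeCrystallizesHullCriterion
import Summits.AtomisticToContinuum.Crystallization.Theorems.ExcessDecayLiouvilleCrysEnergyLimit
import Summits.AtomisticToContinuum.Crystallization.Theorems.PhononSlackCertificatesWindowOptimality
import HarnessLib.Audit.Status.Attr

/-!
Route: GappedShellCensus

DORMANT since 2026-08-26T14:19:41Z (reconciler: no traction for 6.6 d (last activity item-proof-filed at 2026-08-19T22:25:47Z); parked, not closed — `ledger route dormant route-AtomisticToContinuum-GappedShellCensus --off` to reactivate) — unstaffed, not closed; items shared with open routes are served there. `ledger route dormant <id> --off` reactivates.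

It suffices to show X = CleanLocalLimit ∧ CleanLimitsHaveWindows (unchanged). REPAIRED 2026-08-17
after the refutation of the original
computational crux ShellCensus (stmt-15929) by the TORN ICOSAHEDRON
(GappedShellCensusShellCensus_refuted: a gapped twelve-shell at
(2 %, 63/50) with 25 bonds and seven 5-valent vertices, > 2/5 from fcc, hcp and the prism; the
planner's own census kit j019259 found the
same boundary zoo: 288 of 1023 survivors in ≈ 50 classes with 20–25 bonds and shell vertices of
bond-degree 2, 3 or 5). CleanLocalLimit
(TARGET, the hinge): every sequence of Lennard-Jones ground states has a CLEAN LOCAL LIMIT — an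
infinite Y ∋ 0, a local limit of translates
of a subsequence, and a scale a ∈ [47/50, 1] at which EVERY site is GAPPED-TWELVE (twelve points of
Y in [0.98a, 1.02a], none closer, none
in the open annulus (1.02a, 1.26a)) with its rescaled bond shell 1/5-close to the fcc or hcp kissing
pattern. It is now reached through:
ShellTrichotomy (rank 4, COMPUTATIONAL and true by design — a gapped twelve-shell is (A) 1/5-close
to fcc/hcp, or (B) CAPPED: a shell point
with ≥ 5 shell-neighbours, or (C) TORN: a shell point with ≤ 3 shell-neighbours; the certificate
only has to 1/5-match the all-degree-4
(8,6)-mosaics — cuboctahedral/anticuboctahedral flex varieties cut by the gap, observed max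
displacement 0.151), TornFree (rank 2, NEW: in an
ALL-gapped-twelve configuration no shell is torn — every bond has ≥ 4 common neighbours; the gapped
2 %-tolerant Flatley–Theil Conjecture 2.2,
a k-centre finite statement), RadialDefectsVanish (rank 3, unchanged: the only, purely RADIAL,
energy→structure statement),
FiveFoldRationingR (rank 6: an all-gapped-twelve torn-free configuration has five-ring-free balls of
every radius — curvature-sign rationing),
glued by CleanLimitExtractionR (rank 9). CleanLimitsHaveWindows (rank 5, unchanged): clean local
limits of ground states have periodic windows;
then the proved hull criterion, window optimality and energy limit give both Blanc–Lewin conjuncts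
with the same P. The refuted ShellCensus
stays in the file as a settled negative edge; the pre-repair FiveFoldRationing /
CleanLimitExtraction are re-kinded support (superseded, kept
so that landed files importing this file elaborate).
Lean: `CleanLocalLimit ∧ CleanLimitsHaveWindows`

Rationale: WHY THIS LINE. Every local-classification line on this sub died at the same place — a single
twelve-shell at positive tolerance is not
fcc/hcp (DecahedralSoftShell; EffectiveLocalHales refuted; 0758 moot; BrittleRungDescent at 1/400;
HullExactificationCascade at η = 0) — and
this route's first cut died one step further out: even WITH the Hales gap, the (2 %, 63/50)-shell
space is not three patterns but a boundary
zoo (torn and capped shells: kit j019259, 53 classes; refuter's torn icosahedron, Lean). The repair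
keeps the line's architecture (energy asked
only a RADIAL question; every angular fact from finite geometry + curvature-sign rationing;
exactification in the hull) and moves the
computation to where it is cheap and true by design: a DICHOTOMY census (ShellTrichotomy:
fcc/hcp-close OR capped OR torn — only the
all-degree-4 (8,6)-mosaics need a certificate, a low-dimensional interval computation around the
cuboctahedral/anticuboctahedral flexes;
data: all 503 all-degree-4 survivors of j019259 are within 0.151 of fcc or hcp under optimal
assignment), and isolates the genuinely new
geometric statement the zoo exposes: TornFree — in an ALL-gapped-twelve configuration no shell is
torn (every bond has ≥ 4 common
neighbours), the gapped tolerant form of Flatley–Theil 2015 Conj. 2.2 (at τ = 0 with the gap it is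
Hales 2012 Thm 3), itself a finite
k-centre statement certifiable by the same interval technology once k is fixed. Sources: Hales2012,
FlatleyTheil2015, MusinTarasov2012,
arXiv:1410.2536, arXiv:1611.10297 (KKLS), BuragoGromovPerelman1992, arXiv:1708.08211,
BoroczkySzabo2016, BlancLewin2015; the repair follows
the crux-ideate dossier Cruxes/ShellCensus/NOTES.md (option R3) and the route review / refutation
evidence on stmt-15929.
RANKED CRUXES. #2 TornFree (NEW, geometric, XL: the real crux of the line — why it might fail: an
all-gapped-twelve TORN crystal built from
torn icosahedral / bicuboctahedral shells sharing their voids). #3 RadialDefectsVanish (energy, XL,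
unchanged). #4 ShellTrichotomy (COMPUTATIONAL,
M: (8,6)-mosaic matching; why it might fail: a third all-degree-4 map or a flex beyond 1/5). #5
CleanLimitsHaveWindows (hull energetics, XL,
unchanged). #6 FiveFoldRationingR (comparison geometry, L). #9 CleanLimitExtractionR (bridge, M).
Target #0 CleanLocalLimit. Settled: ShellCensus
(#2 old) REFUTED; FiveFoldRationing / CleanLimitExtraction re-kinded support (superseded).
KILL CRITERIA. (i) An all-gapped-twelve torn configuration (finite k-centre cluster first, then a
periodic torn crystal) refutes TornFree:
close refuted:TornFree and file 'torn gapped crystals' as a barrier — the single-radial-shell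
interface is then dead and only a second radial
shell (card second-radial-shell) or a stronger energy ask remains. (ii) An all-degree-4 gapped shell
> 1/5 from fcc/hcp refutes ShellTrichotomy:
misstatement repair (larger η up to the fcc–hcp bottleneck 0.378/2, or a fourth syntactic branch).
(iii) R-dense five-fold axes in a torn-free
all-gapped configuration refute FiveFoldRationingR: close. (iv)/(v) as before (RadialDefectsVanish
only by a theorem on true ground states;
PeriodicWindows proved elsewhere moots the hull half).
NOT DECOMPOSED YET. k of the k-centre form of TornFree and its cluster instance set (crux chain);
the (8,6)/(9,4,1) map list and the flex
parametrisation of ShellTrichotomy's certificate; octet cellulation + curvature budget inside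
FiveFoldRationingR; layering / strain
exactification / stacking inside CleanLimitsHaveWindows; the (τ, γ)-map of the shell zoo (kit
j020961 running: {0.5, 1, 2} % × {1.30, 1.35, 1.38}).
CHEAPEST FALSIFIER. TornFree: a two- /three-centre cluster scan — centre y with a torn shell
(degree-2/3 vertex v), v and the torn bond's ends
completed to gapped-twelve — one kit job (≤ 50 points, all-twelve constraints on the inner sites);
nine points DO fit in v's far super-hemisphere
{φ ≥ 78.1°} by area, so two centres alone are probably not enough and the scan must go to the shells
of v's neighbours. ShellTrichotomy: done —
optimal-assignment displacement of every all-degree-4 class of j019259 ≤ 0.151 (local_match.py on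
stmt-18070).

Novelty: Searches (2026-08-16): hub — all 74 Crystallization route files (heads; PhononSlackCertificates,
DecahedralSoftShell, KissingPatterns,
TwoShellPatterns read in full), 26 open + 95 closed card titles
(square-well-mixture-averaged-kissing, signed-frustration-alexandrov-rigidity
read in full), `ledger negatives` (2 crystal entries), items 0758/0751/3240–3243/0626/0627; grep of
Theses/Ideas/Theorems for Tammes (16/28/20:
always the strong-13 CAP or Tammes radii as numbers), Musin (19/18/22: idem), plantri 0/0/0,
'interval Newton'/Krawczyk 1/1/1 (unrelated),
jitterbug (6/16/2: octet-truss floppiness), 'shell census' (0/3: garland cards noting prior art has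
none), Alexandrov (1/2), quasi-twelve (6/6:
cited as a risk, unread everywhere); literature — `lit search` local index DOWN (searchd connection
reset, logged), crossref 'quasi-twelve-neighbour
Böröczky Szabó' (8: BS15, BS16 found; both paywalled → acq-00697/00699 cite-only), zbMATH (1, review
licence-blocked), OpenAlex/S2 rate-limited
(429), `lit galaxy search "12-neighbour packing" --star all` (1: Handbook DCG 3e ch. 2, read
in-book: Fejes Tóth conjecture, Hales 2013 / BS15 via
strong 13), `lit galaxy search "quasi-twelve-neighbour packing" --star all` (0), web abstract of
BS16 (constructs ε-quasi-12-neighbour packings, no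
two balls touching, 'with some surprising properties'), `lit read arXiv:1604.02776` (Five essays on
L. Fejes Tóth: Tammes/13-spheres references).
Nearest prior art found: MusinTarasov2012 + arXiv:1410.2536 (c  [refs: 1604.02776, 1410.2536, MusinTarasov2012, Hales2012, BoroczkySzabo2015]

Barriers (technique_class: certified-shell-enumeration; alexandrov-rationing; hull): - technique_class: certified-shell-enumeration; alexandrov-rationing; hull
- Literature.Barriers.AtomisticToContinuum.DecahedralSoftShell: evaded by construction — the
decahedral-axis shell is a LISTED census type, never excluded at a single centre; its exclusion is
global (FiveFoldRationing) and energy-free; the census is the complete analysis the barrier's scope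
caveat (b) asks for ('other non-FCC/HCP soft shells … may exist — not analysed').
- Literature.Barriers.AtomisticToContinuum.FlexibleKissingArrangements: a single soft shell is
flexible; the gap removes the icosahedral branch and cuts the jitterbug at ≈ 10.8°, and the census
only LABELS types up to 1/5 — rigidity is never inferred from one shell (it enters through the octet
truss in CleanLimitsHaveWindows, on all-good infinite configurations).
- Literature.Barriers.AtomisticToContinuum.KissingTwelveDegeneracy / ShortRangeStackingBlindness:
untouched, not claimed — stacking selection is imported in CleanLimitsHaveWindows via
LjRegistryDomination (3063) in the hull; the census and the rationing end at 'Barlow-like'.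
- Literature.Barriers.AtomisticToContinuum.TetrahedralFrustration: used as the resource (5θ_T < 2π
is the sign of the only surviving frustrated type); no single-cell density functional is bounded.
- Literature.Barriers.AtomisticToContinuum.IcosahedralClusters: finite icosahedral/decahedral ground
states have compressed cores and five-fold axes of zero density; RadialDefectsVanish is a density
statement, Fi

History (route lifecycle, newest last):
- 2026-08-16T22:46:19Z · BROKEN — ShellCensus (stmt-AtomisticToContinuum-15929, crux) refuted by Summit.AtomisticToContinuum.Crystallization.Theorems.GappedShellCensusShellCensus_refuted @ 96cd8b3e9d0d (refuter-rattack-stmt-AtomisticToContinuum-15929-0)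
- 2026-08-17T00:19:07Z · rev 5: restated Assembly (stmt-AtomisticToContinuum-15934 proved) — repair step 3: drop the REFUTED crux ShellCensus (stmt-15929, torn icosahedron) and the superseded bridge CleanLimitExtraction (stmt-15933, its antecedent list (planner-plan-lens-AtomisticToContinuum-certcrux-v2-0)
- 2026-08-17T00:19:07Z · rev 5: dropped ShellCensus, CleanLimitExtraction — repair step 3: drop the REFUTED crux ShellCensus (stmt-15929, torn icosahedron) and the superseded bridge CleanLimitExtraction (stmt-15933, its antecedent list (planner-plan-lens-AtomisticToContinuum-certcrux-v2-0)
- 2026-08-17T00:19:07Z · REPAIRED (restate Assembly; drop ShellCensus, CleanLimitExtraction) — back to open: repair step 3: drop the REFUTED crux ShellCensus (stmt-15929, torn icosahedron) and the superseded bridge CleanLimitExtraction (stmt-15933, its antecedent list (planner-plan-lens-AtomisticToContinuum-certcrux-v2-0)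
- 2026-08-26T14:19:41Z · DORMANT — reconciler: no traction for 6.6 d (last activity item-proof-filed at 2026-08-19T22:25:47Z); parked, not closed — `ledger route dormant route-AtomisticToContinuu (operator:999:1760130)

sub-problem: Crystallization · status: dormant · opened planner-plan-lens-AtomisticToContinuum-certcrux-v2-0 2026-08-16T16:06:12Z · rev 5 · ledger route-AtomisticToContinuum-GappedShellCensus
GENERATED by the gate from the ledger (D-0016/17). Provers cite these decls: `theorem foo : Summit.AtomisticToContinuum.Crystallization.Theses.GappedShellCensus.<Decl> := …` in Summits/AtomisticToContinuum/Crystallization/Theorems/<Name>.lean.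
-/

namespace Summit.AtomisticToContinuum.Crystallization.Theses.GappedShellCensus

open scoped BigOperators Topology Manifold Classical MeasureTheory ProbabilityTheory Matrix InnerProductSpace ComplexConjugate ContinuousMap
open Filter Set Function TopologicalSpace MeasureTheory

attribute [summit_statement] _root_.Crystallization

/-- item stmt-AtomisticToContinuum-15928 · target · rank 0 · open · by planner
why it might fail: Fails iff in every local limit of every translate family, decahedral axes or radial defects (≠ 12 bonds within 2 %, or neighbours in the annulus (1.02a, 1.26a)) are R-dense at some scale R — e.g. ground states that are asymptotically polytetrahedral or > 2 %-strained on positive fractions.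
sources: BlancLewin2015, Hales2012, Doye2000, Literature.Barriers.AtomisticToContinuum.DecahedralSoftShell
[target] every sequence of LJ ground states has a clean local limit: an infinite Y ∋ 0 that is a
local limit of translates of a subsequence (two-way ε-matched on B(0,R) eventually, for all R, ε)
and a scale a ∈ [47/50,1] such that every y ∈ Y is gapped-twelve at (a, 1/50, 63/50) and its
rescaled bond shell is 1/5-close (ShellCloseTo) to fccKissingPattern or hcpKissingPattern. -/
@[route_item "route-AtomisticToContinuum-GappedShellCensus"]
def CleanLocalLimit : Prop :=
  ∀ x : (N : ℕ) → (Fin N → EuclideanSpace ℝ (Fin 3)), (∀ N, Literature.MathematicalPhysics.StatisticalMechanics.IsGroundState Literature.MathematicalPhysics.StatisticalMechanics.lennardJones (x N)) → ∃ (Y : Set (EuclideanSpace ℝ (Fin 3))) (a : ℝ), 47 / 50 ≤ a ∧ a ≤ 1 ∧ (0 : EuclideanSpace ℝ (Fin 3)) ∈ Y ∧ (∃ (φ : ℕ → ℕ) (t : ℕ → EuclideanSpace ℝ (Fin 3)), StrictMono φ ∧ ∀ R ε : ℝ, 0 < ε → ∀ᶠ n in Filter.atTop, (∀ y ∈ Y,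 ‖y‖ ≤ R → ∃ i : Fin (φ n), dist (x (φ n) i + t n) y ≤ ε) ∧ (∀ i : Fin (φ n), ‖x (φ n) i + t n‖ ≤ R → ∃ y ∈ Y, dist (x (φ n) i + t n) y ≤ ε)) ∧ ∀ y ∈ Y, ({w ∈ Y | w ≠ y ∧ dist y w ≤ a * (1 + 1 / 50)}.ncard = 12 ∧ ∀ w ∈ Y, w ≠ y → a * (1 - 1 / 50) ≤ dist y w ∧ (dist y w ≤ a * (1 + 1 / 50) ∨ a * (63 / 50) ≤ dist y w)) ∧ ∃ T : Finset (EuclideanSpace ℝ (Fin 3)), (↑T : Set (EuclideanSpace ℝ (Fin 3))) = (fun w => a⁻¹ • (w - y)) '' {w ∈ Y | w ≠ y ∧ dist y w ≤ a * (1 + 1 / 50)} ∧ (Literature.Geometry.DiscreteGeometry.ShellCloseTo (1 / 5) T Literature.Geometry.DiscreteGeometry.fccKissingPattern ∨ Literature.Geometry.DiscreteGeometry.ShellCloseTo (1 / 5) T Literature.Geometry.DiscreteGeometry.hcpKissingPattern)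

/-- item stmt-AtomisticToContinuum-18069 · crux · rank 2 · open · by planner
why it might fail: A periodic all-gapped-twelve TORN crystal (a bond with ≤ 3 commons; torn icosahedral/bicuboctahedral shells sharing voids): at τ = 1/50 torn two- and three-centre exactly-twelve clusters exist (p141804, p142415; allgap slack +0.0032), so nothing below 4 joint centres forbids it.
sources: FlatleyTheil2015, Hales2012, BoroczkySzabo2016, Summits/AtomisticToContinuum/Crystallization/Cruxes/TornFree/Disproof.lean, Summits/AtomisticToContinuum/Crystallization/Cruxes/TornFree/Lines/Sketch.lean, kit:j022883
[crux] TORN-FREE (NEW after the refutation of ShellCensus; the gapped, 2 %-tolerant form of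
Flatley–Theil 2015 Conjecture 2.2, which at tolerance 0 WITH the Hales gap is Hales 2012 Thm 3): in
a configuration Y ⊂ ℝ³ in which EVERY site is gapped-twelve at scale a (twelve points of Y in
[0.98a, 1.02a], none closer, none in (1.02a, 1.26a)), every bond (y, v) has at least FOUR common
bonded neighbours — no shell of Y is torn (no shell vertex of bond-degree ≤ 3). Heuristic: a
≤3-valent shell vertex leaves an empty wedge ≥ 31° around the bond (tetrahedral/half-octahedral
dihedrals 70.5°/109.5° ± O(τ)); sites bordering the void cannot all keep twelve bonds without a
point in the forbidden annulus. A finite k-centre statement in disguise (only the ≤ 37–50 points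
within 2.04a of y matter) — certifiable by interval branch-and-bound once k is fixed by the crux
chain (two centres are probably NOT enough: nine points fit in v's far super-hemisphere {φ ≥
78.1°}). why it might fail: an all-gapped-twelve TORN configuration — e.g. a periodic crystal built
from torn icosahedral / torn bicuboctahedral shells (21–23 bonds per shell, degree-2/3 shell
vertices, freed pairs parked at ≥ 1.26a) in which th -/
@[route_item "route-AtomisticToContinuum-GappedShellCensus", crux (experiment := "instrument: kit jobs cited as sources kit:j022883, kit:j022929") (source := "ledger wanted_by.sources on stmt-AtomisticToContinuum-18069, 2026-09-01")]
def TornFree : Prop :=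
  ∀ (Y : Set (EuclideanSpace ℝ (Fin 3))) (a : ℝ), 0 < a → (∀ y ∈ Y, ({w ∈ Y | w ≠ y ∧ dist y w ≤ a * (1 + 1 / 50)}.ncard = 12 ∧ ∀ w ∈ Y, w ≠ y → a * (1 - 1 / 50) ≤ dist y w ∧ (dist y w ≤ a * (1 + 1 / 50) ∨ a * (63 / 50) ≤ dist y w))) → ∀ y ∈ Y, ∀ v ∈ Y, v ≠ y → dist y v ≤ a * (1 + 1 / 50) → 4 ≤ {w ∈ Y | w ≠ y ∧ w ≠ v ∧ dist y w ≤ a * (1 + 1 / 50) ∧ dist v w ≤ a * (1 + 1 / 50)}.ncard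

/-- item stmt-AtomisticToContinuum-15930 · crux · rank 3 · open · by planner
why it might fail: Ground states could carry a positive fraction of > 2 %-strained sites (unrelaxed multiply-twinned / Frank–Kasper-like bulk tied with hcp within o(1) per particle), or two bulk scales a ≠ a′ (no single a for the sequence); only a theorem about true ground states refutes it.
sources: BlancLewin2015, Theil2006, FlatleyTheil2015, Stillinger2001, arXiv:1409.4508, Literature.Barriers.AtomisticToContinuum.IcosahedralClusters
[crux] RADIAL DEFECTS VANISH (the only energy→structure statement of the line, purely radial): for
every sequence of LJ ground states there is ONE scale a ∈ [47/50, 1] such that for every θ > 0,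
frequently in N, all but θN particles i are gapped-twelve at scale a: exactly twelve j with |x_j −
x_i| ∈ [a(1−1/50), a(1+1/50)], no j closer than a(1−1/50), and no j in the open annulus (a(1+1/50),
63a/50). Implied by the coercive cruxes of PhononSlackCertificates (CoerciveTwoShellGap) and
ReggeStarCoercivity (StarCoercivity), and the intended output of the layer-cake / averaged-kissing
engine of card square-well-mixture-averaged-kissing (its K1+K2 give exactly 'twelve in
[d,(1+o(1))d], none up to 2d/√3' a.e.). [difficulty: XL] -/
@[route_item "route-AtomisticToContinuum-GappedShellCensus", crux]
def RadialDefectsVanish : Prop :=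
  ∀ x : (N : ℕ) → (Fin N → EuclideanSpace ℝ (Fin 3)), (∀ N, Literature.MathematicalPhysics.StatisticalMechanics.IsGroundState Literature.MathematicalPhysics.StatisticalMechanics.lennardJones (x N)) → ∃ a : ℝ, 47 / 50 ≤ a ∧ a ≤ 1 ∧ ∀ θ : ℝ, 0 < θ → ∃ᶠ N in Filter.atTop, (Nat.card {i : Fin N // ¬ ((Finset.univ.filter fun j : Fin N => j ≠ i ∧ dist (x N i) (x N j) ≤ a * (1 + 1 / 50)).card = 12 ∧ ∀ j : Fin N, j ≠ i → a * (1 - 1 / 50) ≤ dist (x N i) (x N j) ∧ (dist (x N i) (x N j) ≤ a * (1 + 1 / 50) ∨ a * (63 / 50) ≤ dist (x N i) (x N j)))} : ℝ) ≤ θ * N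

/-- item stmt-AtomisticToContinuum-18070 · crux · rank 4 · open · by planner
why it might fail: An all-degree-4 gapped shell realising a third (8,6) map or a pentagon-bearing (9,4,1) map farther than 1/5 from fcc and hcp, or an anticuboctahedral flex exceeding displacement 1/5 before the gap cuts it (observed max 0.151, kit j019259 + local_match.py).
sources: Hales2012, FlatleyTheil2015, MusinTarasov2012, arXiv:1410.2536, arXiv:1611.10297, kit:j019259
[crux][computational] THE DICHOTOMY CENSUS (repair R3 of the refuted ShellCensus; TRUE BY DESIGN up
to one small certified piece): every gapped twelve-shell T (12 points, norms in [0.98, 1.02],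
pairwise distances in [0.98, 1.02] ∪ [1.26, ∞)) is (A) 1/5-close after a linear isometry to the fcc
or the hcp kissing pattern, or (B) CAPPED: some shell point has ≥ 5 shell points within 1.02 (a
closed five-ring through the centre — the decahedral prism, the torn icosahedra, …), or (C) TORN:
some shell point has ≤ 3 shell points within 1.02. Content = branch (A) for shells with ALL
shell-degrees exactly 4: by Euler + corner windows these are the 24-bond (8 triangles, 6 quads)
mosaics — cuboctahedron, anticuboctahedron and their tolerance-thickened flex varieties (jitterbug
cut at 10.8° by the gap) plus any other all-(2T+2Q)/(3T+Q,T+3Q) (8,6) map that realises; certificate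
= (i) the finite list of 4-regular 12-vertex plane maps with face vector (8,6)
[(9,4,1),(10,2,2),(11,0,3) killed or matched likewise] (plantri / by hand;
finite-graph-witness-engine), (ii) per map an interval computation in flex × rigid coordinates
bounding the displacement to fcc/hcp by < 1/5 or proving infeasibility (int -/
@[route_item "route-AtomisticToContinuum-GappedShellCensus", crux (experiment := "instrument: kit jobs cited as sources kit:j019259") (source := "ledger wanted_by.sources on stmt-AtomisticToContinuum-18070, 2026-09-01")]
def ShellTrichotomy : Prop :=
  ∀ T : Finset (EuclideanSpace ℝ (Fin 3)), T.card = 12 → (∀ v ∈ T, 1 - 1 / 50 ≤ ‖v‖ ∧ ‖v‖ ≤ 1 + 1 / 50) → (∀ v ∈ T, ∀ w ∈ T, v ≠ w → 1 - 1 / 50 ≤ dist v w ∧ (dist v w ≤ 1 + 1 / 50 ∨ 63 / 50 ≤ dist v w)) → Literature.Geometry.DiscreteGeometry.ShellCloseTo (1 / 5) T Literature.Geometry.DiscreteGeometry.fccKissingPattern ∨ Literature.Geometry.DiscreteGeometry.ShellCloseTo (1 / 5) T Literature.Geometry.DiscreteGeometry.hcpKissingPattern ∨ (∃ v ∈ T,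 5 ≤ (T.filter fun w => w ≠ v ∧ dist v w ≤ 1 + 1 / 50).card) ∨ (∃ v ∈ T, (T.filter fun w => w ≠ v ∧ dist v w ≤ 1 + 1 / 50).card ≤ 3)

/-- item stmt-AtomisticToContinuum-15932 · crux · rank 5 · open · by planner
why it might fail: A syndetic fault pattern in every energy-minimising layered limit (aperiodic optimal LJ stacking: Hägg domination fails on the 2 % strain box), or residual strain that no translate-limit removes because layered coercivity fails for some relaxed polytype (a soft shear branch).
sources: BlancLewin2015, Hales2012, FlatleyTheil2015, Stillinger2001, stmt-AtomisticToContinuum-3063, stmt-AtomisticToContinuum-3242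
[crux] CLEAN LIMITS HAVE PERIODIC WINDOWS: if Y ∋ 0 is a local limit of translates of a subsequence
of a sequence of LJ ground states x^N, with a scale a ∈ [47/50,1] at which every site of Y is
gapped-twelve with fcc- or hcp-close shell, then x has periodic windows at every scale (one periodic
P, for all R, ε, frequently in N, some translate of x^N two-way ε-matched with P.points on B(0,R)).
Mechanism: (a) layering from shapes — an all-fcc/hcp-shell gapped configuration is a
(1+C/50)-bi-Lipschitz image of a Barlow stacking (the octet truss is infinitesimally rigid, twins
are hcp planes, non-parallel twins need non-alphabet junction sites, absent here); (b) strain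
exactification — Y inherits ground-state minimality under compact modifications and energy density
e*, and strained layered configurations have energy density > e* (layered coercivity;
finite-dimensional certified core: relaxed hcp is the strict minimiser over uniformly strained
stackings), so some translate-limit of Y is an exact Barlow stacking; (c) stacking selection in the
hull by Hägg domination (LjRegistryDomination, stmt-AtomisticToContinuum-3063) ⇒ hcp windows; (d)
windows of Y transfer to x^N by the matching. [dif -/
@[route_item "route-AtomisticToContinuum-GappedShellCensus", crux]
def CleanLimitsHaveWindows : Prop :=
  ∀ x : (N : ℕ) → (Fin N → EuclideanSpace ℝ (Fin 3)), (∀ N, Literature.MathematicalPhysics.StatisticalMechanics.IsGroundState Literature.MathematicalPhysics.StatisticalMechanics.lennardJones (x N)) → ∀ (Y : Set (EuclideanSpace ℝ (Fin 3))) (a : ℝ), 47 / 50 ≤ a → a ≤ 1 → (0 : EuclideanSpace ℝ (Fin 3)) ∈ Y → (∃ (φ : ℕ → ℕ) (t : ℕ → EuclideanSpace ℝ (Fin 3)), StrictMono φ ∧ ∀ R ε : ℝ, 0 < ε → ∀ᶠ n in Filter.atTop, (∀ y ∈ Y, ‖y‖ ≤ R → ∃ i : Fin (φ n), dist (x (φ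 n) i + t n) y ≤ ε) ∧ (∀ i : Fin (φ n), ‖x (φ n) i + t n‖ ≤ R → ∃ y ∈ Y, dist (x (φ n) i + t n) y ≤ ε)) → (∀ y ∈ Y, ({w ∈ Y | w ≠ y ∧ dist y w ≤ a * (1 + 1 / 50)}.ncard = 12 ∧ ∀ w ∈ Y, w ≠ y → a * (1 - 1 / 50) ≤ dist y w ∧ (dist y w ≤ a * (1 + 1 / 50) ∨ a * (63 / 50) ≤ dist y w)) ∧ ∃ T : Finset (EuclideanSpace ℝ (Fin 3)), (↑T : Set (EuclideanSpace ℝ (Fin 3))) = (fun w => a⁻¹ • (w - y)) '' {w ∈ Y | w ≠ y ∧ dist y w ≤ a * (1 + 1 / 50)} ∧ (Literature.Geometry.DiscreteGeometry.ShellCloseTo (1 / 5) T Literature.Geometry.DiscreteGeometry.fccKissingPattern ∨ Literature.Geometry.DiscreteGeometry.ShellCloseTo (1 / 5) T Literature.Geometry.DiscreteGeometry.hcpKissingPattern)) → ∃ P : Literature.MathematicalPhysics.StatisticalMechanics.PeriodicConfiguration 3, ∀ R ε : ℝ, 0 < ε → ∃ᶠ N in Filter.atTop, ∃ t : EuclideanSpace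 ℝ (Fin 3), (∀ s ∈ P.points, ‖s‖ ≤ R → ∃ i : Fin N, dist (x N i + t) s ≤ ε) ∧ (∀ i : Fin N, ‖x N i + t‖ ≤ R → ∃ s ∈ P.points, dist (x N i + t) s ≤ ε)

/-- item stmt-AtomisticToContinuum-18071 · crux · rank 6 · open · by planner
why it might fail: An all-gapped-twelve torn-free configuration with R-dense five-fold axes at bounded strain (same-sign axis forest; BoroczkySzabo2016?), or torn-free capped shell types beyond the prism (26+ bonds) that tile space.
sources: BuragoGromovPerelman1992, arXiv:1708.08211, Hales2012, BoroczkySzabo2016, SadocMosseri1999, Literature.Barriers.AtomisticToContinuum.DecahedralSoftShell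
[crux] FIVE-FOLD RATIONING (repaired: typed by five-rings instead of the prism pattern): if every
site of Y ≠ ∅ is gapped-twelve at scale a and Y is torn-free (every bond has ≥ 4 common neighbours),
then for every R there is a site c ∈ Y such that no bond (y, v) with y within R of c has ≥ 5 common
neighbours — five-ring-free (uncapped) balls of every radius; with the trichotomy, every shell in
such a ball is 1/5-close to fcc/hcp. Intended proof unchanged: torn-free + gapped-twelve ⇒
face-to-face T/O cellulation with ring words (2,2),(5,0) (corner bookkeeping: at 25 bonds the only
torn-free capped type is the prism); sign of frustration below ≈ 2.5 % ⇒ ideal Regge metric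
Alexandrov ≥ 0 ⇒ five-ring length in B_L is O(L) (card signed-frustration-alexandrov-rigidity
(B)–(D); DecahedralRodNote on stmt-15929: the all-gapped decahedral rod at 0.669 % shows five-rings
DO propagate, so they must be rationed, not excluded). why it might fail: an all-gapped-twelve
torn-free configuration with R-dense five-fold axes at bounded strain (same-sign axis forest), or
torn-free capped shells other than the prism (26+ bonds) that tile. sources:
BuragoGromovPerelman1992, arXiv:1708.08211, Hales2012, Bo -/
@[route_item "route-AtomisticToContinuum-GappedShellCensus", crux]
def FiveFoldRationingR : Prop :=
  ∀ (Y : Set (EuclideanSpace ℝ (Fin 3))) (a : ℝ), 0 < a → Y.Nonempty → (∀ y ∈ Y, ({w ∈ Y | w ≠ y ∧ dist y w ≤ a * (1 + 1 / 50)}.ncard = 12 ∧ ∀ w ∈ Y, w ≠ y → a * (1 - 1 / 50) ≤ dist y w ∧ (dist y w ≤ a * (1 + 1 / 50) ∨ a * (63 / 50) ≤ dist y w))) → (∀ y ∈ Y, ∀ v ∈ Y, v ≠ y → dist y v ≤ a * (1 + 1 / 50) → 4 ≤ {w ∈ Y | w ≠ y ∧ w ≠ v ∧ dist y w ≤ a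 * (1 + 1 / 50) ∧ dist v w ≤ a * (1 + 1 / 50)}.ncard) → ∀ R : ℝ, ∃ c ∈ Y, ∀ y ∈ Y, dist y c ≤ R → ∀ v ∈ Y, v ≠ y → dist y v ≤ a * (1 + 1 / 50) → {w ∈ Y | w ≠ y ∧ w ≠ v ∧ dist y w ≤ a * (1 + 1 / 50) ∧ dist v w ≤ a * (1 + 1 / 50)}.ncard ≤ 4

/-- item stmt-AtomisticToContinuum-18072 · crux · rank 9 · closed · proved by Summit.AtomisticToContinuum.Crystallization.Theorems.cleanLimitExtractionR_proof @ 47e75f72d5a3 (prover) · by planner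
why it might fail: Only bookkeeping: shell-degree of v in the rescaled shell of y must equal the common-neighbour count of the bond (y,v); finiteness/uniqueness of the shell Finset from the local hard core; closedness of gapped-twelve under local limits (stub landed: stub_cleGappedOfLimit).
sources: BlancLewin2015, Xue1997, Hales2012
[crux] THE BRIDGE (repaired, soft; crux-kind only because `closes` consumes it): RadialDefectsVanish
→ ShellTrichotomy → TornFree → FiveFoldRationingR → CleanLocalLimit. As before (ball counting with
the proved 1/3-separation, compactness, closedness of gapped-twelve under local limits,
re-centring/diagonal), now: TornFree excludes branch (C) at every site of the all-gapped-twelve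
limit Y₀, FiveFoldRationingR gives balls of every radius with no 5-common-neighbour bond (no branch
(B)), so in those balls the trichotomy yields (A) = 1/5-closeness to fcc/hcp; re-extract to an
all-clean Y. why it might fail: only bookkeeping (shell-degree of v in the rescaled shell of y =
number of common neighbours of the bond (y,v); finiteness/uniqueness of the shell Finset from the
local hard core). sources: BlancLewin2015, Xue1997, Hales2012. [deps: RadialDefectsVanish,
ShellTrichotomy, TornFree, FiveFoldRationingR] [difficulty: M] -/
@[route_item "route-AtomisticToContinuum-GappedShellCensus", crux]
def CleanLimitExtractionR : Prop :=
  RadialDefectsVanish → ShellTrichotomy → TornFree → FiveFoldRationingR → CleanLocalLimit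

-- `CleanLimitExtractionR` holds: proved by `Summit.AtomisticToContinuum.Crystallization.Theorems.cleanLimitExtractionR_proof` @ 47e75f72d5a3 (its module imports this route file, so no `_holds` link can be stated here).

/-- item stmt-AtomisticToContinuum-15931 · aside · rank 4 · open · by planner
why it might fail: An all-gapped-twelve configuration whose five-fold axes are R-dense at bounded strain (a same-sign axis forest screened without opposite-sign carriers) — conceivably among the ε-quasi-twelve-neighbour packings 'with surprising properties' (BoroczkySzabo2016, unread, paywalled acq-00697).
sources: BuragoGromovPerelman1992, arXiv:1708.08211, Hales2012, BoroczkySzabo2016, SadocMosseri1999, Doye2000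
[crux] FIVE-FOLD RATIONING (pure geometry on the census alphabet, energy-free): if Y ⊂ ℝ³ and a > 0
are such that EVERY y ∈ Y is gapped-twelve at (a, 1/50, 63/50) and its rescaled bond shell is
1/5-close to the fcc, hcp or decahedral-axis pattern, and Y is non-empty, then for every R there is
a site c ∈ Y such that every y ∈ Y within R of c has an fcc- or hcp-close shell (decahedral-free
balls of every radius). Intended proof: the typed configuration is a face-to-face
tetrahedron/octahedron cellulation with ring words (2,2) and (5,0) only; its ideal Regge metric has
cone angles ≤ 2π, i.e. Alexandrov curvature ≥ 0 (sign of frustration below ≈ 2.5 %); Bishop–Gromov /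
link at infinity bound the five-ring length in B_L by O(L), so clean balls of radius ~L^{2/3} exist
in every B_L (programme and constants of card signed-frustration-alexandrov-rigidity, (B)–(D)).
[deps: ShellCensus] [difficulty: L] -/
@[route_item "route-AtomisticToContinuum-GappedShellCensus"]
def FiveFoldRationing : Prop :=
  ∀ (Y : Set (EuclideanSpace ℝ (Fin 3))) (a : ℝ), 0 < a → Y.Nonempty → (∀ y ∈ Y, ({w ∈ Y | w ≠ y ∧ dist y w ≤ a * (1 + 1 / 50)}.ncard = 12 ∧ ∀ w ∈ Y, w ≠ y → a * (1 - 1 / 50) ≤ dist y w ∧ (dist y w ≤ a * (1 + 1 / 50) ∨ a * (63 / 50) ≤ dist y w)) ∧ ∃ T : Finset (EuclideanSpace ℝ (Fin 3)), (↑T : Set (EuclideanSpace ℝ (Fin 3))) = (fun w => a⁻¹ • (w - y)) '' {w ∈ Y | w ≠ y ∧ dist y w ≤ a * (1 + 1 / 50)} ∧ (Literature.Geometry.DiscreteGeometry.ShellCloseTo (1 / 5) T Literature.Geometry.DiscreteGeometry.fccKissingPattern ∨ Literature.Geometry.DiscreteGeometry.ShellCloseTo (1 / 5) T Literature.Geometry.DiscreteGeometry.hcpKissingPattern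 ∨ Literature.Geometry.DiscreteGeometry.ShellCloseTo (1 / 5) T ((Finset.univ.image fun k : Fin 5 => !₂[Real.sqrt 3 / 2 * Real.cos (2 * Real.pi * k / 5), Real.sqrt 3 / 2 * Real.sin (2 * Real.pi * k / 5), (1 : ℝ) / 2]) ∪ (Finset.univ.image fun k : Fin 5 => !₂[Real.sqrt 3 / 2 * Real.cos (2 * Real.pi * k / 5), Real.sqrt 3 / 2 * Real.sin (2 * Real.pi * k / 5), -(1 : ℝ) / 2]) ∪ {!₂[(0 : ℝ), 0, 1], !₂[(0 : ℝ), 0, -1]}))) → ∀ R : ℝ, ∃ c ∈ Y, ∀ y ∈ Y, dist y c ≤ R → ∃ T : Finset (EuclideanSpace ℝ (Fin 3)), (↑T : Set (EuclideanSpace ℝ (Fin 3))) = (fun w => a⁻¹ • (w - y)) '' {w ∈ Y | w ≠ y ∧ dist y w ≤ a * (1 + 1 / 50)} ∧ (Literature.Geometry.DiscreteGeometry.ShellCloseTo (1 / 5) T Literature.Geometry.DiscreteGeometry.fccKissingPattern ∨ Literature.Geometry.DiscreteGeometry.ShellCloseTo (1 / 5) T Literature.Geometry.DiscreteGeometry.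hcpKissingPattern)

-- earlier Assembly (stmt-AtomisticToContinuum-15934, replaced 2026-08-17T00:19:07Z -> stmt-AtomisticToContinuum-16776): proved by Summit.AtomisticToContinuum.Crystallization.Theorems.gappedShellCensus_assembly_proof @ a37868f37240 — ShellCensus → RadialDefectsVanish → FiveFoldRationing → CleanLimitExtraction → CleanLimitsHaveWindows → _root_.Crystallization
/-- item stmt-AtomisticToContinuum-16776 · assembly · rank 1 · closed · proved by Summit.AtomisticToContinuum.Crystallization.Theorems.gappedShellCensus_assembly_rev5_proof @ 7c30f6ed2fe2 (prover) · by planner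
sources: BlancLewin2015, Hales2012
[assembly] ShellTrichotomy → RadialDefectsVanish → TornFree → FiveFoldRationingR →
CleanLimitExtractionR → CleanLimitsHaveWindows → Crystallization (proof = body of the repaired
`closes`; restated 2026-08-17 after the refutation of ShellCensus — the pre-repair chain began with
the refuted ShellCensus). -/
@[route_item "route-AtomisticToContinuum-GappedShellCensus"]
def Assembly : Prop :=
  ShellTrichotomy → RadialDefectsVanish → TornFree → FiveFoldRationingR → CleanLimitExtractionR → CleanLimitsHaveWindows → _root_.Crystallization

-- `Assembly` holds: proved by `Summit.AtomisticToContinuum.Crystallization.Theorems.gappedShellCensus_assembly_rev5_proof` @ 7c30f6ed2fe2 (its module imports this route file, so no `_holds` link can be stated here).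

-- records of items no longer active in this route (dropped / restated):
-- earlier ShellCensus (stmt-AtomisticToContinuum-15929, dropped 2026-08-17T00:19:07Z): refuted by Summit.AtomisticToContinuum.Crystallization.Theorems.GappedShellCensusShellCensus_refuted @ 96cd8b3e9d0d — ∀ T : Finset (EuclideanSpace ℝ (Fin 3)), T.card = 12 → (∀ v ∈ T, 1 - 1 / 50 ≤ ‖v‖ ∧ ‖v‖ ≤ 1 + 1 / 50) → (∀ v ∈ T, ∀ w ∈ T, v ≠ w → 1 - 1 / 50 ≤ dist v w ∧ (dist v w ≤ 1 + 1 / 50 ∨ 63 / 50 ≤ dist v 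

/-! D-0027 §2.1 — DECIDING THEOREM (planner-authored via `route open/edit --closes-file`; by planner-plan-lens-AtomisticToContinuum-certcrux-v2-0 2026-08-17T00:14:13Z):
its hypotheses are this route's items and its conclusion the sub-problem Statement (glue_lint), and it elaborates with this file. -/

@[closes "route-AtomisticToContinuum-GappedShellCensus"] theorem closes (h_ShellTrichotomy : ShellTrichotomy) (h_RadialDefectsVanish : RadialDefectsVanish) (h_TornFree : TornFree)
    (h_FiveFoldRationingR : FiveFoldRationingR) (h_CleanLimitExtractionR : CleanLimitExtractionR)
    (h_CleanLimitsHaveWindows : CleanLimitsHaveWindows) : _root_.Crystallization := by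
  -- (1) the hinge: every sequence of ground states has a clean local limit (radial defects + trichotomy + torn-free + rationing, via the
  --     repaired bridge crux; REPAIR 2026-08-17 after the refutation of ShellCensus by the torn icosahedron)
  have hCL : CleanLocalLimit := h_CleanLimitExtractionR h_RadialDefectsVanish h_ShellTrichotomy h_TornFree h_FiveFoldRationingR
  -- (2) clean local limits have periodic windows ⇒ PERIODIC WINDOWS for every sequence of ground states
  --     (the shared statement stmt-AtomisticToContinuum-3240, here in the spelling of route HullMinimality so that the
  --     proved hull criterion applies verbatim)
  have hPW : _root_.Summit.AtomisticToContinuum.Crystallization.Theses.HullMinimality.PeriodicWindows := by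
    intro x hx
    obtain ⟨Y, a, ha1, ha2, h0, hlim, hclean⟩ := hCL x hx
    exact h_CleanLimitsHaveWindows x hx Y a ha1 ha2 h0 hlim hclean
  -- (3) positional conjunct (ii) via the hull criterion (stmt-3243, PROVED in tree: PrestressSplitKorn.stub_hullCriterion)
  have hpos : Literature.MathematicalPhysics.StatisticalMechanics.IsCrystallizing
      Literature.MathematicalPhysics.StatisticalMechanics.lennardJones 3 :=
    _root_.Summit.AtomisticToContinuum.Crystallization.Theorems.PrestressSplitKorn.stub_hullCriterion hPW
  -- (4) energetic conjunct (i): ground states exist (proved Literature theorem); their periodic window P is a least-energy periodic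
  --     configuration (stmt-13962 WindowOptimality, PROVED in tree: windowOptimality_proof), hence ⨅ = e(P), and E(N)/N → e(P) by the
  --     proved energy limit (stmt-0626, crysEnergyLimit_proof).
  have hex : Literature.MathematicalPhysics.StatisticalMechanics.LennardJonesGroundStatesExist :=
    Literature.MathematicalPhysics.StatisticalMechanics.LennardJonesGroundStatesExist_holds
  obtain ⟨x, hx⟩ : ∃ x : (N : ℕ) → (Fin N → EuclideanSpace ℝ (Fin 3)), ∀ N,
      Literature.MathematicalPhysics.StatisticalMechanics.IsGroundState
        Literature.MathematicalPhysics.StatisticalMechanics.lennardJones (x N) :=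
    ⟨fun N => (hex N).choose, fun N => (hex N).choose_spec⟩
  obtain ⟨P, hP⟩ := hPW x hx
  have hleast : IsLeast (Set.range fun Q : Literature.MathematicalPhysics.StatisticalMechanics.PeriodicConfiguration 3 =>
      Q.energyPerParticle Literature.MathematicalPhysics.StatisticalMechanics.lennardJones)
      (P.energyPerParticle Literature.MathematicalPhysics.StatisticalMechanics.lennardJones) :=
    _root_.Summit.AtomisticToContinuum.Crystallization.Theorems.windowOptimality_proof x hx P hP
  have hinf : (⨅ Q : Literature.MathematicalPhysics.StatisticalMechanics.PeriodicConfiguration 3,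
      Q.energyPerParticle Literature.MathematicalPhysics.StatisticalMechanics.lennardJones) =
      P.energyPerParticle Literature.MathematicalPhysics.StatisticalMechanics.lennardJones := hleast.csInf_eq
  have hlim : Filter.Tendsto (fun N : ℕ => Literature.MathematicalPhysics.StatisticalMechanics.groundStateEnergy
      Literature.MathematicalPhysics.StatisticalMechanics.lennardJones 3 N / N) Filter.atTop
      (nhds (P.energyPerParticle Literature.MathematicalPhysics.StatisticalMechanics.lennardJones)) := by
    have hEL := _root_.Summit.AtomisticToContinuum.Crystallization.Theorems.crysEnergyLimit_proof
    unfold Summit.AtomisticToContinuum.Crystallization.Theses.ExcessDecayLiouville.CrysEnergyLimit at hEL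
    rw [hinf] at hEL
    exact hEL
  exact ⟨⟨P, hleast, hlim⟩, hpos⟩

end Summit.AtomisticToContinuum.Crystallization.Theses.GappedShellCensus
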